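/- Copyright: the b2b-balaban cell (near-miss cell 7), T⁴-continuum fan-out; row NE7b ROUND-2 swarm, seat
t4-ne7b-formalise-leaf-08 (gen 8) (beside row S4c part 3b `HistoryExitLE`, leaf-02; own-initiative smallness-census item
F-leaf08g8-1, ADDENDUM «the other component of the pinned window», OFFER 2; v1.1 leaf-08 gen 12: §4 floors BY NAME, append-only).
Released under the licence of the surrounding project. -/
import Summits.QuantumFields.BalabanUV.T4Continuum.Support.HistoryExitLE

/-!
# History pay threshold: AN EXPLICIT INFRARED THRESHOLD FOR THE PAY SIDE, AT THE ROOT LEVEL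

Summits-side support leaf of the T⁴-continuum cell (rung (B)+1 on a FINITE torus only; NOT infinite volume, NOT the
mass gap, NOT the Clay statement; NOT a proof of the spine estimate NE7b).  Claim table
`t4/b2b-balaban-t4-ne7b-p1/LEAVES-NE7b.md`, beside row S4c part 3b (`HistoryExitLE`, leaf-02): the named threshold of
record `HistoryExitLE.irThresholdTLE C L r β₀` is `Classical.choose` over `T4TaggedShapeBanking.exists_payThreshold`, so NO
SIZE of it is derivable in the kernel (the first factor `min 1 e^{−irThresholdTLE∕2}` of the pinned END's coupling window
is sizeless by construction); and the WITNESS inside that existence proof solves each γ-clause `B ≤ c·A₀·x^n` LINEARLY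
(`x ≥ max 1 (B∕(c·A₀))`, using `x ≤ x^n`), e.g. its merger clause alone is `≥ L^{2q′+1}(1+β₀)²((1+n₁)E₂ + dC·E₃)∕A₀`.

WHAT (smallness census, finding F-leaf08g8-1 addendum; [folklore] real arithmetic + compositions BY NAME with
`T4TaggedShapeBanking.payIneqs_of_flow`, `HistoryTreeShapeLE.rawFactorLE_of_pay`,
`HistoryBankingLEInduction.exists_relWeightBound_of_rawFactorLE`; TWO real-valued bookkeeping definitions — the clause
threshold `rootClause` and the explicit pay threshold `payThresholdRoot`, functions of the symbolic constants
`(C, L, r, β₀)` only (c2∕c6) — no `Prop`-valued definition (c1), no `[cite:]` tag, nothing printed asserted):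
* §1 `rootClause B cA n := max 1 ((B∕cA)^{1∕n})` — **`le_mul_pow_of_rootClause_le`**: `rootClause B cA n ≤ x ⇒ B ≤ cA·x^n`
  (`cA > 0`, `n ≥ 1`; the root companion of `T4PersistentHistoryCount.gammaClause_of_large`), `rootClause_le_linClause`
  (`≤ max 1 (B∕cA)` for `B ≥ 0`: the root threshold is never above the linear one).
* §2 **`payThresholdRoot C L r β₀`** := the max of the SEVEN root clauses of `payIneqs_of_flow` with the budgets of
  `exists_payThreshold` (`c₁ = c₂ = 1∕(2(1+β₀))`, `c₃ = c₄ = 1∕(1+β₀)`, `c₅ = c₆ = 1`, birth threshold `2(1+β₀) ≤ a·A₀·x^{p₀}`);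
  **`payLE_of_payThresholdRoot`** — EXACTLY the three scale-indexed pay inequalities of `exists_payThreshold` ∕
  `HistoryExitLE.payLE_of_irThreshold`, along every run of the typed flow ((2.7), (2.5), `1 ≤ log g_s⁻²`) whose infrared
  value has `payThresholdRoot C L r β₀ ≤ log g_K⁻²`; `one_le_payThresholdRoot`.
* §3 **`rawFactorLE_of_payThresholdRoot`** (= `HistoryExitLE.rawFactorLE_of_irThreshold` at the explicit threshold) and
  **`relWeightBound_canon_of_payThresholdRootLE`** — THE COUNT EXIT `HistoryExitLE.relWeightBound_canon_of_irThresholdLE`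
  VERBATIM with the single binder `hir` re-lettered `irThresholdTLE C L r β₀ ↦ payThresholdRoot C L r β₀`; proof = the
  same one-line composition.  The socket ∕ END chain of record keeps the named `irThresholdTLE`; this file only shows
  that the exit — hence any re-plug of the chain — is available at an EXPLICIT threshold whose every clause is a
  `(p₀ − r)`-th, `(p₀ − r(q′+1))`-th or `p₀`-th ROOT of a closed-form ratio of the symbolic constants.

HONEST.  Bookkeeping on the cell's OWN thresholds; discharges nothing of H3 ∕ (B) ∕ BetaPertH ∕ NE7c ∕ NE7 ∕ the rates;
NE7b NOT proved; spine PROVED 0∕9.  HONEST DEPENDENCY (cell): continuum YM on T⁴ ⇐ BetaPertH ∧ nine spine estimates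
(0/9 proved); BetaPertH ⇐ (D1) ∧ (D4) ∧ CAP+tail; G-an2-4 gates asym, D1 and NE2/3/4.  Unchanged here.
-/

open Finset
open Literature.MathematicalPhysics.QuantumFieldTheory.Balaban1983to89
open T4PersistenceDictionary T4PersistentHistoryCount T4BankedInduction T4PrintedShapeBanking
open T4WeightBudget T4GlobalDenominator T4LiveClassFibration T4LiveStructureGas T4LiveGasToTerms T4RecordPriceSeam
open T4PartnerMultiplicity T4BranchingRecordsGas T4TaggedShapeBanking T4CanonicalMenus T4CountHorizon
open Summit.QuantumFields.BalabanUV.T4Continuum.LateMergers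
open Summit.QuantumFields.BalabanUV.T4Continuum.HistoryBankingLE
open Summit.QuantumFields.BalabanUV.T4Continuum.HistoryBankingLEInduction
open Summit.QuantumFields.BalabanUV.T4Continuum.HistoryTreeShapeLE
open Summit.QuantumFields.BalabanUV.T4Continuum.CountThresholdUniform
open Summit.QuantumFields.BalabanUV.T4Continuum.HistoryExitLE

namespace Summit.QuantumFields.BalabanUV.T4Continuum.HistoryPayThresholdRoot

noncomputable section

/-! ## §1 The root clause: `B ≤ cA·x^n` from `x ≥ max 1 ((B∕cA)^{1∕n})` -/

section Clause

/-- **THE ROOT CLAUSE THRESHOLD** `max 1 ((B∕cA)^{1∕n})` of the γ-clause `B ≤ cA·x^n` (a real number; bookkeeping). [folklore] -/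
def rootClause (B cA : ℝ) (n : ℕ) : ℝ := max 1 ((B / cA) ^ ((n : ℝ)⁻¹))

/-- `1 ≤ rootClause B cA n`. [folklore] -/
theorem one_le_rootClause (B cA : ℝ) (n : ℕ) : 1 ≤ rootClause B cA n := le_max_left _ _

/-- **THE ROOT CLAUSE PAYS**: for `cA > 0`, `n ≥ 1`, every `x ≥ rootClause B cA n` has `B ≤ cA·x^n` — the companion of
`T4PersistentHistoryCount.gammaClause_of_large` with the `n`-th power USED rather than discarded. [folklore] -/
theorem le_mul_pow_of_rootClause_le {B cA : ℝ} {n : ℕ} (hcA : 0 < cA) (hn : 1 ≤ n) {x : ℝ} (hx : rootClause B cA n ≤ x) :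
    B ≤ cA * x ^ n := by
  have hx1 : 1 ≤ x := le_trans (one_le_rootClause B cA n) hx
  rcases le_or_gt (B / cA) 1 with hy | hy
  · have hB : B ≤ cA := by rwa [div_le_one hcA] at hy
    calc B ≤ cA := hB
      _ = cA * 1 := (mul_one cA).symm
      _ ≤ cA * x ^ n := mul_le_mul_of_nonneg_left (one_le_pow₀ hx1) hcA.le
  · have hy0 : 0 ≤ B / cA := zero_le_one.trans hy.le
    have hroot : (B / cA) ^ ((n : ℝ)⁻¹) ≤ x := le_trans (le_max_right _ _) hx
    have hpow : ((B / cA) ^ ((n : ℝ)⁻¹)) ^ n ≤ x ^ n :=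
      pow_le_pow_left₀ (Real.rpow_nonneg hy0 _) hroot n
    rw [Real.rpow_inv_natCast_pow hy0 (by omega)] at hpow
    calc B = cA * (B / cA) := by field_simp
      _ ≤ cA * x ^ n := mul_le_mul_of_nonneg_left hpow hcA.le

/-- **THE ROOT CLAUSE IS NEVER ABOVE THE LINEAR ONE** (`B ≥ 0`, `cA > 0`, `n ≥ 1`): `rootClause B cA n ≤ max 1 (B∕cA)` —
the threshold of `gammaClause_of_large`. [folklore] -/
theorem rootClause_le_linClause {B cA : ℝ} {n : ℕ} (hB : 0 ≤ B) (hcA : 0 < cA) (hn : 1 ≤ n) :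
    rootClause B cA n ≤ max 1 (B / cA) := by
  have hy0 : 0 ≤ B / cA := div_nonneg hB hcA.le
  have hinv0 : 0 ≤ ((n : ℝ)⁻¹) := inv_nonneg.2 (Nat.cast_nonneg n)
  have hinv1 : ((n : ℝ)⁻¹) ≤ 1 := inv_le_one_of_one_le₀ (by exact_mod_cast hn)
  unfold rootClause
  rcases le_or_gt 1 (B / cA) with hy | hy
  · exact max_le_max le_rfl (Real.rpow_le_self_of_one_le hy hinv1)
  · have h1 : (B / cA) ^ ((n : ℝ)⁻¹) ≤ 1 := Real.rpow_le_one hy0 hy.le hinv0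
    calc max 1 ((B / cA) ^ ((n : ℝ)⁻¹)) = 1 := max_eq_left h1
      _ ≤ max 1 (B / cA) := le_max_left _ _

end Clause

/-! ## §2 The explicit pay threshold and its specification -/

section Threshold

/-- **THE EXPLICIT PAY THRESHOLD (root level)**: the max of the seven root clauses feeding
`T4TaggedShapeBanking.payIneqs_of_flow` with the budgets of `exists_payThreshold` — renewal (`c₁ = c₂ = 1∕(2(1+β₀))`),
merger (`c₃ = c₄ = 1∕(1+β₀)`), birth (`c₅ = c₆ = 1`) and the birth threshold `2(1+β₀) ≤ a·A₀·x^{p₀}`.  A real number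
depending on the symbolic constants `(C, L, r, β₀)` only. [folklore] -/
def payThresholdRoot (C : T4PrintedShapeBanking.Consts) (L r : ℕ) (β₀ : ℝ) : ℝ :=
  max (max (max (rootClause ((L : ℝ) * (1 + β₀) * (2 * C.κ₁ + C.E₀)) (1 / (2 * (1 + β₀)) * C.A₀) (C.p₀ - r))
        (rootClause ((L : ℝ) ^ (C.q' + 1) * (1 + β₀) * (2 * C.E₂ * (L : ℝ) ^ C.q')) (1 / (2 * (1 + β₀)) * C.A₀)
          (C.p₀ - r * (C.q' + 1))))
      (max (rootClause ((L : ℝ) * (1 + β₀) * ((1 + (C.n₁ : ℝ)) * C.κ₁ + C.E₀)) (1 / (1 + β₀) * C.A₀) (C.p₀ - r))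
        (rootClause ((L : ℝ) ^ (C.q' + 1) * (1 + β₀) *
            ((1 + C.n₁) * C.E₂ * (L : ℝ) ^ C.q' + C.dC * C.E₃ * (L : ℝ) ^ C.q')) (1 / (1 + β₀) * C.A₀)
          (C.p₀ - r * (C.q' + 1)))))
    (max (max (rootClause ((L : ℝ) * (1 + β₀) * (C.Eb + C.μ)) (1 * C.A₀) (C.p₀ - r))
        (rootClause ((L : ℝ) ^ (C.q' + 1) * (1 + β₀) *
            (3 * C.E₂ * (L : ℝ) ^ C.q' + C.E₃ * (L : ℝ) ^ C.q' + 3 * C.κ₁)) (1 * C.A₀) (C.p₀ - r * (C.q' + 1))))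
      (rootClause (2 * (1 + β₀)) (C.a * C.A₀) C.p₀))

variable {C : T4PrintedShapeBanking.Consts} {L r : ℕ} {β₀ : ℝ}

/-- `1 ≤ payThresholdRoot C L r β₀`. [folklore] -/
theorem one_le_payThresholdRoot (C : T4PrintedShapeBanking.Consts) (L r : ℕ) (β₀ : ℝ) :
    1 ≤ payThresholdRoot C L r β₀ :=
  le_trans (one_le_rootClause _ _ _) ((le_max_right _ _).trans (le_max_right _ _))

/-- **THE EXPLICIT THRESHOLD'S SPECIFICATION** — the body of `T4TaggedShapeBanking.exists_payThreshold` AT THE EXPLICIT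
VALUE: for valid symbolic constants with `a, A₀ > 0`, `L ≥ 1`, `β₀ ≥ 0`, `r(q′+1) < p₀`, along every run of the typed
flow ((2.7), (2.5), `1 ≤ log g_s⁻²`) with `payThresholdRoot C L r β₀ ≤ log g_K⁻²`, the three scale-indexed pay
inequalities (birth, renewal, merger) hold at the cutoff `K` — `payIneqs_of_flow` BY NAME, each γ-clause from
`le_mul_pow_of_rootClause_le`. [folklore] -/
theorem payLE_of_payThresholdRoot (hC : C.Valid) (ha : 0 < C.a) (hA : 0 < C.A₀) (hL : 1 ≤ L) (hβ : 0 ≤ β₀)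
    (hrq : r * (C.q' + 1) < C.p₀) (K : ℕ) (R : ℕ → ℕ) (g : ℕ → ℝ) (β' : ℝ)
    (h27 : B14.FlowIneq27 g β' β₀ C.p₀ K) (hR : ∀ s, s ≤ K → B14.IsRj L r (g s) (R s))
    (hx1 : ∀ s, s ≤ K → 1 ≤ Real.log ((g s) ^ 2)⁻¹) (hx : payThresholdRoot C L r β₀ ≤ Real.log ((g K) ^ 2)⁻¹) :
    (∀ s, s ≤ K → ∀ d' : ℕ,
        (C.Eb + C.μ + (3 * C.E₂ * (L : ℝ) ^ C.q' + C.E₃ * (L : ℝ) ^ C.q' + 3 * C.κ₁) * (R s : ℝ) ^ (C.q' + 1)) *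
            ((d' : ℝ) + 1) + 2 * p0Profile C.A₀ C.p₀ (g s) ≤
          C.a * (p0Profile C.A₀ C.p₀ (g s)) ^ 2 * ((d' : ℝ) + 1) + 2 * p0Profile C.A₀ C.p₀ (g s)) ∧
      (∀ h, h + 1 ≤ K →
        2 * C.E₂ * (L : ℝ) ^ C.q' * (R (h + 1) : ℝ) ^ (C.q' + 1) + (C.κ₁ * ((R (h + 1) : ℝ) + 1) + C.E₀) ≤
          p0Profile C.A₀ C.p₀ (g h)) ∧
      (∀ m s, m ≤ s → s ≤ K →
        ((1 + C.n₁) * C.E₂ * (L : ℝ) ^ C.q' + C.dC * C.E₃ * (L : ℝ) ^ C.q') * (R s : ℝ) ^ (C.q' + 1) +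
            (C.κ₁ * ((C.n₁ : ℝ) + R s) + C.E₀) ≤ 2 * p0Profile C.A₀ C.p₀ (g m)) := by
  set xK := Real.log ((g K) ^ 2)⁻¹ with hxK
  have hrp : r < C.p₀ := lt_of_le_of_lt (Nat.le_mul_of_pos_right r (Nat.succ_pos _)) hrq
  have hn₁ : 1 ≤ C.p₀ - r := by omega
  have hn₂ : 1 ≤ C.p₀ - r * (C.q' + 1) := by omega
  have hn₃ : 1 ≤ C.p₀ := by omega
  have hb0 : (0 : ℝ) < 1 + β₀ := by linarith
  have hcR : 0 < 1 / (2 * (1 + β₀)) * C.A₀ := by positivity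
  have hcM : 0 < 1 / (1 + β₀) * C.A₀ := by positivity
  have hc1 : 0 < (1 : ℝ) * C.A₀ := by simpa using hA
  have hcB : 0 < C.a * C.A₀ := mul_pos ha hA
  -- the seven clauses, each below the explicit threshold
  have h₁ := le_mul_pow_of_rootClause_le hcR hn₁
    (le_trans ((le_max_left _ _).trans ((le_max_left _ _).trans (le_max_left _ _))) hx)
  have h₂ := le_mul_pow_of_rootClause_le hcR hn₂
    (le_trans ((le_max_right _ _).trans ((le_max_left _ _).trans (le_max_left _ _))) hx)
  have h₃ := le_mul_pow_of_rootClause_le hcM hn₁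
    (le_trans ((le_max_left _ _).trans ((le_max_right _ _).trans (le_max_left _ _))) hx)
  have h₄ := le_mul_pow_of_rootClause_le hcM hn₂
    (le_trans ((le_max_right _ _).trans ((le_max_right _ _).trans (le_max_left _ _))) hx)
  have h₅ := le_mul_pow_of_rootClause_le hc1 hn₁
    (le_trans ((le_max_left _ _).trans ((le_max_left _ _).trans (le_max_right _ _))) hx)
  have h₆ := le_mul_pow_of_rootClause_le hc1 hn₂
    (le_trans ((le_max_right _ _).trans ((le_max_left _ _).trans (le_max_right _ _))) hx)
  have h₇ := le_mul_pow_of_rootClause_le hcB hn₃ (le_trans ((le_max_right _ _).trans (le_max_right _ _)) hx)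
  have hthr : (1 + β₀) * (1 + 1) ≤ C.a * p0Profile C.A₀ C.p₀ (g K) := by
    unfold p0Profile
    calc (1 + β₀) * (1 + 1) = 2 * (1 + β₀) := by ring
      _ ≤ C.a * C.A₀ * xK ^ C.p₀ := h₇
      _ = C.a * (C.A₀ * xK ^ C.p₀) := by ring
  have hb₁ : (1 + β₀) * (1 / (2 * (1 + β₀)) + 1 / (2 * (1 + β₀))) ≤ 1 := by
    rw [show (1 + β₀) * (1 / (2 * (1 + β₀)) + 1 / (2 * (1 + β₀))) = 1 by field_simp; ring]
  have hb₂ : (1 + β₀) * (1 / (1 + β₀) + 1 / (1 + β₀)) ≤ 2 := by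
    rw [show (1 + β₀) * (1 / (1 + β₀) + 1 / (1 + β₀)) = 2 by field_simp; ring]
  exact payIneqs_of_flow hC ha.le hA.le h27 hR hrp.le hrq.le hL hβ
    (by positivity) (by positivity) (by positivity) (by positivity) zero_le_one zero_le_one hx1
    h₁ h₂ hb₁ h₃ h₄ hb₂ h₅ h₆ hthr

/-- … in the letters of `CountThresholdUniform.ThresholdOK`. [folklore] -/
theorem payLE_of_thresholdRoot (h : ThresholdOK C L r β₀) (K : ℕ) (R : ℕ → ℕ) (g : ℕ → ℝ) (β' : ℝ)
    (h27 : B14.FlowIneq27 g β' β₀ C.p₀ K) (hR : ∀ s, s ≤ K → B14.IsRj L r (g s) (R s))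
    (hx1 : ∀ s, s ≤ K → 1 ≤ Real.log ((g s) ^ 2)⁻¹) (hir : payThresholdRoot C L r β₀ ≤ Real.log ((g K) ^ 2)⁻¹) :
    (∀ s, s ≤ K → ∀ d' : ℕ,
        (C.Eb + C.μ + (3 * C.E₂ * (L : ℝ) ^ C.q' + C.E₃ * (L : ℝ) ^ C.q' + 3 * C.κ₁) * (R s : ℝ) ^ (C.q' + 1)) *
            ((d' : ℝ) + 1) + 2 * p0Profile C.A₀ C.p₀ (g s) ≤
          C.a * (p0Profile C.A₀ C.p₀ (g s)) ^ 2 * ((d' : ℝ) + 1) + 2 * p0Profile C.A₀ C.p₀ (g s)) ∧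
      (∀ h, h + 1 ≤ K →
        2 * C.E₂ * (L : ℝ) ^ C.q' * (R (h + 1) : ℝ) ^ (C.q' + 1) + (C.κ₁ * ((R (h + 1) : ℝ) + 1) + C.E₀) ≤
          p0Profile C.A₀ C.p₀ (g h)) ∧
      (∀ m s, m ≤ s → s ≤ K →
        ((1 + C.n₁) * C.E₂ * (L : ℝ) ^ C.q' + C.dC * C.E₃ * (L : ℝ) ^ C.q') * (R s : ℝ) ^ (C.q' + 1) +
            (C.κ₁ * ((C.n₁ : ℝ) + R s) + C.E₀) ≤ 2 * p0Profile C.A₀ C.p₀ (g m)) :=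
  payLE_of_payThresholdRoot h.valid h.a_pos h.A₀_pos h.one_le_L h.β₀_nonneg h.rq_lt K R g β' h27 hR hx1 hir

end Threshold

/-! ## §3 The raw-factor bound and the COUNT exit at the explicit threshold -/

section Exit

variable {C : T4PrintedShapeBanking.Consts} {L r : ℕ} {β₀ : ℝ}
variable {ε : Type*} [DecidableEq ε]

/-- **THE RAW-FACTOR BOUND AT THE EXPLICIT THRESHOLD** (`HistoryExitLE.rawFactorLE_of_irThreshold` with
`irThresholdTLE ↦ payThresholdRoot`): along every run ((2.7), (2.9), (2.5), `1 ≤ log g_s⁻²`) with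
`payThresholdRoot C L r β₀ ≤ log g_K⁻²`, every `ConsistentTLE`, fresh tagged genealogy obeys the raw-factor bound.
[folklore] -/
theorem rawFactorLE_of_payThresholdRoot (sh : ε → PEv) (h : ThresholdOK C L r β₀) (K : ℕ) (R : ℕ → ℕ) (g : ℕ → ℝ)
    (β' : ℝ) (h27 : B14.FlowIneq27 g β' β₀ C.p₀ K) (h29 : B14FlowStep.FlowIneq29 R g L β' β₀ K)
    (hR : ∀ s, s ≤ K → B14.IsRj L r (g s) (R s)) (hx1 : ∀ s, s ≤ K → 1 ≤ Real.log ((g s) ^ 2)⁻¹)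
    (hir : payThresholdRoot C L r β₀ ≤ Real.log ((g K) ^ 2)⁻¹) :
    ∀ G : Gen ε, ConsistentTLE sh C K R G → FreshT G →
      Real.exp (-credits (credit C g ∘ sh) G) * Real.exp (lifeCost (dictWT sh R C.n₁) (costT sh C K R) G) ≤
        (rho C g ∘ sh) G.root * Real.exp (-(C.κ₁ * ((dictWT sh R C.n₁ G.root : ℕ) : ℝ))) *
          ∏ e ∈ G.events.erase G.root,
            (Real.exp (-(C.κ₁ * ((dictWT sh R C.n₁ e : ℕ) : ℝ))) * (eta C ∘ sh) e) := by
  obtain ⟨Hb, Hr, Hm⟩ := payLE_of_thresholdRoot h K R g β' h27 hR hx1 hir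
  intro G hc hf
  exact rawFactorLE_of_pay h.valid h29 h.one_le_L (one_le_R hR h.one_le_L) Hb Hr Hm hc hf

variable {γ κ ι : Type*} [DecidableEq γ] [DecidableEq κ] {l₀ : ℝ} {K₀ : ℕ} {π : ℕ → ι → κ}
  {T : ℕ → Finset ι} {A A' : ℕ → ℝ → ι → ℝ} {Bad' : ℕ → ℝ → Finset κ} {dead dead' : ℕ → ℝ → ι → ℝ}
  {F Rf F' Rf' : ℕ → κ → ℝ} {nlow nup mlow mup : ℕ → ℝ → ℝ} {Cn : ℝ}

/-- **THE COUNT EXIT OVER THE CANONICAL MENUS AT THE EXPLICIT (ROOT) THRESHOLD** —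
`HistoryExitLE.relWeightBound_canon_of_irThresholdLE` VERBATIM with the single binder `hir` re-lettered
`irThresholdTLE C L r β₀ ↦ payThresholdRoot C L r β₀`; the same one-line composition
(`exists_relWeightBound_of_rawFactorLE` with `rawFactorLE_of_payThresholdRoot`). [folklore] -/
theorem relWeightBound_canon_of_payThresholdRootLE (sh : ε → PEv) {C : T4PrintedShapeBanking.Consts} {L r : ℕ}
    {β₀ : ℝ} (h : ThresholdOK C L r β₀) (hμ₀ : 0 < C.μ)
    (Cell : ℕ → ℕ → Finset γ) {V Λ : ℝ} (hV : 0 ≤ V) (hΛ : 0 < Λ)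
    (hcell : ∀ K a, ((Cell K a).card : ℝ) ≤ V * Λ ^ a) (Dcap Ncap : ℕ → ℕ)
    (jstar : ℕ → ℕ) (hj : ∀ K, jstar K ≤ K) {c : ℝ} (hc : 0 < c)
    (hfrac : ∀ K : ℕ, c * K ≤ ((K - jstar K : ℕ) : ℝ)) {Δ : ℝ} (hΔ : 1 ≤ Δ)
    (hA : Regeneration l₀ π T A Bad' dead F Rf nlow nup Cn K₀)
    (hA' : Regeneration l₀ π T A' Bad' dead' F' Rf' mlow mup Cn K₀) (hCn : 0 ≤ Cn)
    (R : ℕ → ℕ → ℕ) (g : ℕ → ℕ → ℝ) (β' : ℕ → ℝ)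
    (h27 : ∀ K, K₀ ≤ K → B14.FlowIneq27 (g K) (β' K) β₀ C.p₀ K)
    (h29 : ∀ K, K₀ ≤ K → B14FlowStep.FlowIneq29 (R K) (g K) L (β' K) β₀ K)
    (hR : ∀ K, K₀ ≤ K → ∀ s, s ≤ K → B14.IsRj L r (g K s) (R K s))
    (hx1 : ∀ K, K₀ ≤ K → ∀ s, s ≤ K → 1 ≤ Real.log ((g K s) ^ 2)⁻¹)
    (hir : ∀ K, K₀ ≤ K → payThresholdRoot C L r β₀ ≤ Real.log ((g K K) ^ 2)⁻¹)
    (hP : ∀ K s, 0 ≤ p0Profile C.A₀ C.p₀ (g K s))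
    {ηplus : ℝ} (hηplus : 0 ≤ ηplus) (hr : Λ * Real.exp (ηplus - C.κ₁) < 1)
    {Λ' : ℝ} (hΛ0 : 0 ≤ Λ') (h1 : Λ' * Real.exp (-C.κ₁) * Real.exp ηplus < 1)
    (hx : (Real.exp (-C.E₀) + Real.exp (-C.E₀) * birthMass C *
          (Λ' * Real.exp (-C.κ₁) / (1 - Λ' * Real.exp (-C.κ₁) * Real.exp ηplus))) * Real.exp ηplus ≤
        Real.exp ηplus - 1)
    (y : ℕ → ℕ → γ → Gen PEv → ℝ)
    (hy0 : ∀ K, ∀ j ≤ K, ∀ z ∈ Cell K (K - j), ∀ G ∈ canonFam Dcap Ncap K j, 0 ≤ y K j z G)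
    (hlabTLE : ∀ K, K₀ ≤ K → ∀ j ≤ K, ∀ z ∈ Cell K (K - j), ∀ G ∈ canonFam Dcap Ncap K j,
      y K j z G ≤ 0 ∨ ∃ G' : Gen ε, ConsistentTLE sh C K (R K) G' ∧ G'.WF (dictWT sh (R K) C.n₁) ∧
        K < G'.reach (dictWT sh (R K) C.n₁) ∧ relabel (shape ∘ sh) G' = G ∧
        y K j z G ≤ Δ * (Λ' ^ partnerAges (PEv.step ∘ sh) G' * (Real.exp (-credits (credit C (g K) ∘ sh) G') *
          Real.exp (lifeCost (dictWT sh (R K) C.n₁) (costT sh C K (R K)) G'))))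
    (str : ℕ → κ → Finset (BSlot γ PEv))
    (hinj : ∀ K t, |t| ≤ l₀ → K₀ ≤ K → Set.InjOn (str K) (Bad' K t))
    (hstr : ∀ K t, |t| ≤ l₀ → K₀ ≤ K → ∀ c ∈ Bad' K t,
      str K c ⊆ bliveSlots Cell (canonFam Dcap Ncap) K ∧
        ∃ o ∈ boldSlots Cell (canonFam Dcap Ncap) jstar K, o ∈ str K c)
    (hF : ∀ K t, |t| ≤ l₀ → K₀ ≤ K → ∀ c ∈ Bad' K t, F K c * Rf K c ≤ famWeight (bslotPrice (y K)) (str K c))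
    (hF' : ∀ K t, |t| ≤ l₀ → K₀ ≤ K → ∀ c ∈ Bad' K t, F' K c * Rf' K c ≤ famWeight (bslotPrice (y K)) (str K c)) :
    ∃ K₁, K₀ ≤ K₁ ∧ RelWeightBound l₀ T A A' (fun K t => if K₁ ≤ K then badOfClass π T Bad' K t else ∅)
      (Set.indicator {K | K₁ ≤ K}
        (fun K => Cn * recordsBudget (Δ * birthMass C) C.κ₁ V Λ ηplus jstar K)) :=
  exists_relWeightBound_of_rawFactorLE sh h.valid.κ₁_nonneg R g
    (fun K hK => rawFactorLE_of_payThresholdRoot sh h K (R K) (g K) (β' K) (h27 K hK) (h29 K hK) (hR K hK)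
      (hx1 K hK) (hir K hK))
    Cell hV hΛ hcell (fun _ => menuRen) (fun _ => menuMer) (dictB Dcap) (dictB Dcap) Ncap (fun _ t => menuMer_step t)
    (fun K j => sum_dictB_rho_le hμ₀ Dcap K j (hP K j)) (fun _ t => (sum_menuRen_eta C t).le)
    (fun _ t => (sum_menuMer_eta C t).le) (fun K s => sum_dictB_eta_le hμ₀ Dcap K s) hηplus hr hΛ0 h1 hx jstar hj hc
    hfrac hΔ y hy0 hlabTLE str hinj hstr hA hA' hF hF' hCn

end Exit

/-! ## §4 (v1.1) Floors of the explicit threshold BY NAME — what binds the explicit window's FIRST factor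

Smallness census, after rows S12o ∕ S12q (2026-08-20; leaf-01 g11's located numbers, journal «FIRST-FACTOR», in this
lineage's lane): the displayed window of `HistoryRealiseCellsRunWindowT3bPc` (p232166) is
`min (min 1 e^{−irThresholdTLE∕2}) (second factor)`; its second factor is the census's «0.31» (p₀ = 23), its first factor
uses the NAMED, sizeless `irThresholdTLE`.  On the only road where the infrared factor HAS a closed form — this file's
`payThresholdRoot` (exit `relWeightBound_canon_of_payThresholdRootLE`) — every one of the seven root clauses is a FLOOR of
the threshold, hence `e^{−payThresholdRoot∕2} ≤ e^{−clause∕2}`: the two lemmas below name the merger clause (the binding one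
at the witness letters, where `p₀ − r(q′+1) = 2q′+1` makes `L^{2q′+1}` come out of the root as a clean factor `L`) and the
birth-threshold clause.  Symbolic (c2∕c6); numbers are journal-only. -/

section Floors

variable (C : T4PrintedShapeBanking.Consts) (L r : ℕ) (β₀ : ℝ)

/-- **THE MERGER CLAUSE IS A FLOOR OF THE EXPLICIT PAY THRESHOLD**: the fourth root clause
`max 1 ((L^{q′+1}(1+β₀)((1+n₁)E₂L^{q′} + dC·E₃·L^{q′}) ∕ (A₀∕(1+β₀)))^{1∕(p₀ − r(q′+1))}) ≤ payThresholdRoot C L r β₀`.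
[folklore] -/
theorem rootClause_merger_le_payThresholdRoot :
    rootClause ((L : ℝ) ^ (C.q' + 1) * (1 + β₀) *
        ((1 + C.n₁) * C.E₂ * (L : ℝ) ^ C.q' + C.dC * C.E₃ * (L : ℝ) ^ C.q')) (1 / (1 + β₀) * C.A₀)
      (C.p₀ - r * (C.q' + 1)) ≤ payThresholdRoot C L r β₀ :=
  le_trans (le_trans (le_max_right _ _) (le_max_right _ _)) (le_max_left _ _)

/-- **THE BIRTH-THRESHOLD CLAUSE IS A FLOOR OF THE EXPLICIT PAY THRESHOLD**: the seventh root clause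
`max 1 ((2(1+β₀) ∕ (a·A₀))^{1∕p₀}) ≤ payThresholdRoot C L r β₀`. [folklore] -/
theorem rootClause_birth_le_payThresholdRoot :
    rootClause (2 * (1 + β₀)) (C.a * C.A₀) C.p₀ ≤ payThresholdRoot C L r β₀ :=
  le_trans (le_max_right _ _) (le_max_right _ _)

/-- **HENCE THE EXPLICIT WINDOW's FIRST FACTOR IS BELOW THE MERGER CLAUSE's**: `exp (−payThresholdRoot∕2) ≤ exp (−(merger
root clause)∕2)` — on the explicit road the infrared factor of the coupling window is at most `e^{−x₄∕2}`, `x₄` the fourth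
root clause (leaf-01 g11: at the witness letters `x₄ ≥ 13·(14·E₂∕A₀)^{1∕11}`, factor ≤ `1.5·10⁻³` once `E₂ ≥ A₀∕14` —
journal-only numbers). [folklore] -/
theorem exp_neg_payThresholdRoot_half_le_merger :
    Real.exp (-(payThresholdRoot C L r β₀) / 2) ≤
      Real.exp (-(rootClause ((L : ℝ) ^ (C.q' + 1) * (1 + β₀) *
        ((1 + C.n₁) * C.E₂ * (L : ℝ) ^ C.q' + C.dC * C.E₃ * (L : ℝ) ^ C.q')) (1 / (1 + β₀) * C.A₀)
      (C.p₀ - r * (C.q' + 1))) / 2) := by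
  have h := rootClause_merger_le_payThresholdRoot C L r β₀
  exact Real.exp_le_exp.2 (by linarith)

end Floors

end

end Summit.QuantumFields.BalabanUV.T4Continuum.HistoryPayThresholdRoot
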